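import Mathlib
import Literature.Probability.LatticeModels.GKSInequalities
import HarnessLib

/-!
# Crux `PrecisionLaplacian.InverseMFerromagnet` (stmt-CriticalPhenomena-4798), line `Sketch` —
# stub `helper_twoSep_markov` (core D structural: Markov factorisation across a 2-separator)

THEOREM-ONLY file (no definitions).  Let `G = (⟨σ_pσ_q⟩)_{p,q}` be the spin second-moment matrix
of the zero-field pair system `gksExpect univ K C` on `Fin n` (`|C i| = 2`), and suppose every
bond lies inside `A` or inside `B := insert c₁ (insert c₂ Aᶜ)` with `c₁, c₂ ∈ A` (so `A ∩ B ⊆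
{c₁, c₂}`: a 2-separator).  We prove, for `x ∈ A`, `y ∈ B`, `ρ := G_{c₁c₂}`,

  `(1 − ρ²) G_{xy} = (G_{yc₁} − ρ G_{yc₂}) G_{xc₁} + (G_{yc₂} − ρ G_{yc₁}) G_{xc₂}`,

i.e. the second moments factor through the separator exactly as for a Gaussian Markov field.

Proof (no sign hypothesis on `K` is used).  Work in Ginibre's duplicated system `(ω, ω')` with
weight `w(ω)w(ω')` and let `Φ` be the twisted swap which replaces the spins of `ω` outside `A` by
`ω_{c₁}ω'_{c₁} ω'` and those of `ω'` outside `A` by `ω_{c₁}ω'_{c₁} ω` (an involution fixing all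
spins in `A`).  On the sector where the two relative signs agree, `ω_{c₁}ω'_{c₁} = ω_{c₂}ω'_{c₂}`,
`Φ` preserves `w(ω)w(ω')`: bonds inside `A` are untouched and bonds inside `B` are exchanged between
the two copies (`twoSep_weight_swap`).  Hence for every `F`,
`∑ F · (1 + σ_{c₁}σ'_{c₁}σ_{c₂}σ'_{c₂}) · ww = ∑ (F ∘ Φ) · (1 + σ_{c₁}σ'_{c₁}σ_{c₂}σ'_{c₂}) · ww`
(`twoSep_sum_swap`; the factor `1 + σ_{c₁}σ'_{c₁}σ_{c₂}σ'_{c₂}` is twice the indicator of the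
sector).  With `F = σ_xσ_y` and `F = σ_xσ_yσ_{c₁}σ_{c₂}` (`x ∈ A`, `y ∉ A`) this gives, writing
`S(f) = ∑ f w`, `Z = S(1)`,
  (I)  `S(σ_xσ_y) Z + S(σ_xσ_yσ_{c₁}σ_{c₂}) S(σ_{c₁}σ_{c₂}) = S(σ_xσ_{c₁}) S(σ_yσ_{c₁}) + S(σ_xσ_{c₂}) S(σ_yσ_{c₂})`,
  (II) `S(σ_xσ_yσ_{c₁}σ_{c₂}) Z + S(σ_xσ_y) S(σ_{c₁}σ_{c₂}) = S(σ_xσ_{c₂}) S(σ_yσ_{c₁}) + S(σ_xσ_{c₁}) S(σ_yσ_{c₂})`,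
and the claim is `(I) − ρ·(II)` after dividing by `Z²`.  For `y ∈ {c₁, c₂}` the identity is a
tautology (`G_{cc} = 1`, `G` symmetric).
-/

namespace Summit.CriticalPhenomena.Ising3DConformalLimit.Cruxes.InverseMFerromagnet.PartialCovarianceLadder

open Literature.Probability.LatticeModels Finset Matrix

/-! ## The twisted swap of the duplicated system -/

/-- Spins of the first copy after the twisted swap `Φ`: inside `A` those of `ω`, outside `A` those
of `ω'` times the relative sign `σ_c(ω)σ_c(ω')`. [folklore] -/
theorem twoSep_spinAt_swap_fst {n : ℕ} (A : Finset (Fin n)) (c : Fin n)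
    (Φ : SpinConfig (Fin n) × SpinConfig (Fin n) → SpinConfig (Fin n) × SpinConfig (Fin n))
    (hΦ : Φ = fun pr => (fun z => if z ∈ A then pr.1 z else pr.1 c * pr.2 c * pr.2 z,
        fun z => if z ∈ A then pr.2 z else pr.1 c * pr.2 c * pr.1 z))
    (pr : SpinConfig (Fin n) × SpinConfig (Fin n)) (z : Fin n) :
    spinAt z (Φ pr).1
      = if z ∈ A then spinAt z pr.1 else spinAt c pr.1 * spinAt c pr.2 * spinAt z pr.2 := by
  subst hΦ
  by_cases hz : z ∈ A <;> simp [spinAt, hz, Units.val_mul, Int.cast_mul]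

/-- Spins of the second copy after the twisted swap `Φ`: inside `A` those of `ω'`, outside `A`
those of `ω` times the relative sign `σ_c(ω)σ_c(ω')`. [folklore] -/
theorem twoSep_spinAt_swap_snd {n : ℕ} (A : Finset (Fin n)) (c : Fin n)
    (Φ : SpinConfig (Fin n) × SpinConfig (Fin n) → SpinConfig (Fin n) × SpinConfig (Fin n))
    (hΦ : Φ = fun pr => (fun z => if z ∈ A then pr.1 z else pr.1 c * pr.2 c * pr.2 z,
        fun z => if z ∈ A then pr.2 z else pr.1 c * pr.2 c * pr.1 z))
    (pr : SpinConfig (Fin n) × SpinConfig (Fin n)) (z : Fin n) :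
    spinAt z (Φ pr).2
      = if z ∈ A then spinAt z pr.2 else spinAt c pr.1 * spinAt c pr.2 * spinAt z pr.1 := by
  subst hΦ
  by_cases hz : z ∈ A <;> simp [spinAt, hz, Units.val_mul, Int.cast_mul]

/-- The twisted swap `Φ` is an involution (`c ∈ A`, so the relative sign is unchanged). [folklore] -/
theorem twoSep_swap_involutive {n : ℕ} (A : Finset (Fin n)) (c : Fin n) (hc : c ∈ A)
    (Φ : SpinConfig (Fin n) × SpinConfig (Fin n) → SpinConfig (Fin n) × SpinConfig (Fin n))
    (hΦ : Φ = fun pr => (fun z => if z ∈ A then pr.1 z else pr.1 c * pr.2 c * pr.2 z,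
        fun z => if z ∈ A then pr.2 z else pr.1 c * pr.2 c * pr.1 z)) :
    Function.Involutive Φ := by
  rintro ⟨ω, ω'⟩
  subst hΦ
  have huu : ∀ a b d : ℤˣ, a * b * (a * b * d) = d := fun a b d => by
    rw [← mul_assoc, Int.units_mul_self, one_mul]
  refine Prod.ext ?_ ?_ <;> funext z <;> by_cases hz : z ∈ A <;> simp [hz, hc, huu]

/-- `(σ_c(ω)σ_c(ω'))² = 1`. [folklore] -/
theorem twoSep_relSign_mul_self {n : ℕ} (c : Fin n) (ω ω' : SpinConfig (Fin n)) :
    spinAt c ω * spinAt c ω' * (spinAt c ω * spinAt c ω') = 1 := by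
  have h1 := spinAt_mul_self c ω
  have h2 := spinAt_mul_self c ω'
  linear_combination (spinAt c ω' * spinAt c ω') * h1 + h2

/-- **Weight invariance on the agreeing sector.** If every bond lies inside `A` or inside
`insert c₁ (insert c₂ Aᶜ)` (`c₁, c₂ ∈ A`, `|C i| = 2`) and the relative signs at the two separator
vertices agree, `σ_{c₁}(ω)σ_{c₁}(ω') = σ_{c₂}(ω)σ_{c₂}(ω')`, then the twisted swap preserves
`w(ω)w(ω')`: bonds inside `A` are untouched, bonds inside the other side are exchanged between the
two copies. [folklore] -/
theorem twoSep_weight_swap {n m : ℕ} (K : Fin m → ℝ) (C : Fin m → Finset (Fin n))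
    (hC : ∀ i, (C i).card = 2) (c₁ c₂ : Fin n) (A : Finset (Fin n)) (hc₁ : c₁ ∈ A) (hc₂ : c₂ ∈ A)
    (hAB : ∀ i, C i ⊆ A ∨ C i ⊆ insert c₁ (insert c₂ Aᶜ))
    (Φ : SpinConfig (Fin n) × SpinConfig (Fin n) → SpinConfig (Fin n) × SpinConfig (Fin n))
    (hΦ : Φ = fun pr => (fun z => if z ∈ A then pr.1 z else pr.1 c₁ * pr.2 c₁ * pr.2 z,
        fun z => if z ∈ A then pr.2 z else pr.1 c₁ * pr.2 c₁ * pr.1 z))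
    (pr : SpinConfig (Fin n) × SpinConfig (Fin n))
    (hagree : spinAt c₁ pr.1 * spinAt c₁ pr.2 = spinAt c₂ pr.1 * spinAt c₂ pr.2) :
    gksWeight Finset.univ K C (Φ pr).1 * gksWeight Finset.univ K C (Φ pr).2
      = gksWeight Finset.univ K C pr.1 * gksWeight Finset.univ K C pr.2 := by
  have htt := twoSep_relSign_mul_self c₁ pr.1 pr.2
  -- spins in `A` are untouched
  have hA1 : ∀ z ∈ A, spinAt z (Φ pr).1 = spinAt z pr.1 := fun z hz => by
    rw [twoSep_spinAt_swap_fst A c₁ Φ hΦ pr z, if_pos hz]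
  have hA2 : ∀ z ∈ A, spinAt z (Φ pr).2 = spinAt z pr.2 := fun z hz => by
    rw [twoSep_spinAt_swap_snd A c₁ Φ hΦ pr z, if_pos hz]
  -- spins on the other side are those of the other copy times the common relative sign
  have hB1 : ∀ z ∈ insert c₁ (insert c₂ Aᶜ),
      spinAt z (Φ pr).1 = spinAt c₁ pr.1 * spinAt c₁ pr.2 * spinAt z pr.2 := by
    intro z hz
    rw [twoSep_spinAt_swap_fst A c₁ Φ hΦ pr z]
    rcases Finset.mem_insert.1 hz with h | hz
    · rw [h, if_pos hc₁, mul_assoc, spinAt_mul_self, mul_one]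
    · rcases Finset.mem_insert.1 hz with h | hz
      · rw [h, if_pos hc₂, hagree, mul_assoc, spinAt_mul_self, mul_one]
      · rw [if_neg (Finset.mem_compl.1 hz)]
  have hB2 : ∀ z ∈ insert c₁ (insert c₂ Aᶜ),
      spinAt z (Φ pr).2 = spinAt c₁ pr.1 * spinAt c₁ pr.2 * spinAt z pr.1 := by
    intro z hz
    rw [twoSep_spinAt_swap_snd A c₁ Φ hΦ pr z]
    rcases Finset.mem_insert.1 hz with h | hz
    · rw [h, if_pos hc₁, mul_right_comm, spinAt_mul_self, one_mul]
    · rcases Finset.mem_insert.1 hz with h | hz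
      · rw [h, if_pos hc₂, hagree, mul_right_comm, spinAt_mul_self, one_mul]
      · rw [if_neg (Finset.mem_compl.1 hz)]
  rw [gksWeight, gksWeight, gksWeight, gksWeight, ← Real.exp_add, ← Real.exp_add]
  congr 1
  simp only [gksHamiltonian, ← Finset.sum_add_distrib]
  refine Finset.sum_congr rfl fun i _ => ?_
  obtain ⟨a, b, hab, hCi⟩ := Finset.card_eq_two.1 (hC i)
  have haC : a ∈ C i := by rw [hCi]; simp
  have hbC : b ∈ C i := by rw [hCi]; simp
  rw [← mul_add, ← mul_add, hCi, spinProduct, spinProduct, spinProduct, spinProduct,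
    Finset.prod_pair hab, Finset.prod_pair hab, Finset.prod_pair hab, Finset.prod_pair hab]
  congr 1
  rcases hAB i with hiA | hiB
  · rw [hA1 a (hiA haC), hA1 b (hiA hbC), hA2 a (hiA haC), hA2 b (hiA hbC)]
  · rw [hB1 a (hiB haC), hB1 b (hiB hbC), hB2 a (hiB haC), hB2 b (hiB hbC)]
    linear_combination (spinAt a pr.2 * spinAt b pr.2 + spinAt a pr.1 * spinAt b pr.1) * htt

/-- **The restricted involution identity.** For every function `F` of the duplicated system,
`∑ F·(1 + σ_{c₁}σ'_{c₁}σ_{c₂}σ'_{c₂})·ww = ∑ (F ∘ Φ)·(1 + σ_{c₁}σ'_{c₁}σ_{c₂}σ'_{c₂})·ww`: reindex by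
the involution `Φ`; the factor `1 + σ_{c₁}σ'_{c₁}σ_{c₂}σ'_{c₂}` is `Φ`-invariant and vanishes off
the agreeing sector, where `Φ` preserves the weight. [folklore] -/
theorem twoSep_sum_swap {n m : ℕ} (K : Fin m → ℝ) (C : Fin m → Finset (Fin n))
    (hC : ∀ i, (C i).card = 2) (c₁ c₂ : Fin n) (A : Finset (Fin n)) (hc₁ : c₁ ∈ A) (hc₂ : c₂ ∈ A)
    (hAB : ∀ i, C i ⊆ A ∨ C i ⊆ insert c₁ (insert c₂ Aᶜ))
    (Φ : SpinConfig (Fin n) × SpinConfig (Fin n) → SpinConfig (Fin n) × SpinConfig (Fin n))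
    (hΦ : Φ = fun pr => (fun z => if z ∈ A then pr.1 z else pr.1 c₁ * pr.2 c₁ * pr.2 z,
        fun z => if z ∈ A then pr.2 z else pr.1 c₁ * pr.2 c₁ * pr.1 z))
    (F : SpinConfig (Fin n) × SpinConfig (Fin n) → ℝ) :
    ∑ pr : SpinConfig (Fin n) × SpinConfig (Fin n),
        F pr * (1 + spinAt c₁ pr.1 * spinAt c₁ pr.2 * (spinAt c₂ pr.1 * spinAt c₂ pr.2))
          * (gksWeight Finset.univ K C pr.1 * gksWeight Finset.univ K C pr.2)
      = ∑ pr : SpinConfig (Fin n) × SpinConfig (Fin n),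
        F (Φ pr) * (1 + spinAt c₁ pr.1 * spinAt c₁ pr.2 * (spinAt c₂ pr.1 * spinAt c₂ pr.2))
          * (gksWeight Finset.univ K C pr.1 * gksWeight Finset.univ K C pr.2) := by
  have hinv := twoSep_swap_involutive A c₁ hc₁ Φ hΦ
  rw [← Equiv.sum_comp (Function.Involutive.toPerm Φ hinv)]
  refine Finset.sum_congr rfl fun pr _ => ?_
  rw [Function.Involutive.coe_toPerm]
  have hA1 : ∀ z ∈ A, spinAt z (Φ pr).1 = spinAt z pr.1 := fun z hz => by
    rw [twoSep_spinAt_swap_fst A c₁ Φ hΦ pr z, if_pos hz]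
  have hA2 : ∀ z ∈ A, spinAt z (Φ pr).2 = spinAt z pr.2 := fun z hz => by
    rw [twoSep_spinAt_swap_snd A c₁ Φ hΦ pr z, if_pos hz]
  rw [hA1 c₁ hc₁, hA2 c₁ hc₁, hA1 c₂ hc₂, hA2 c₂ hc₂]
  by_cases hagree : spinAt c₁ pr.1 * spinAt c₁ pr.2 = spinAt c₂ pr.1 * spinAt c₂ pr.2
  · rw [twoSep_weight_swap K C hC c₁ c₂ A hc₁ hc₂ hAB Φ hΦ pr hagree]
  · have h0 : 1 + spinAt c₁ pr.1 * spinAt c₁ pr.2 * (spinAt c₂ pr.1 * spinAt c₂ pr.2) = 0 := by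
      have hu := twoSep_relSign_mul_self c₁ pr.1 pr.2
      have hv := twoSep_relSign_mul_self c₂ pr.1 pr.2
      have h : (spinAt c₁ pr.1 * spinAt c₁ pr.2 - spinAt c₂ pr.1 * spinAt c₂ pr.2)
          * (1 + spinAt c₁ pr.1 * spinAt c₁ pr.2 * (spinAt c₂ pr.1 * spinAt c₂ pr.2)) = 0 := by
        linear_combination (spinAt c₂ pr.1 * spinAt c₂ pr.2) * hu
          - (spinAt c₁ pr.1 * spinAt c₁ pr.2) * hv
      exact (mul_eq_zero.1 h).resolve_left (sub_ne_zero.2 hagree)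
    simp only [h0, mul_zero, zero_mul]

/-- A product of two unnormalised expectations as one sum over the duplicated system. [folklore] -/
theorem twoSep_gksSum_mul_gksSum {n m : ℕ} (K : Fin m → ℝ) (C : Fin m → Finset (Fin n))
    (f g : SpinConfig (Fin n) → ℝ) :
    gksSum Finset.univ K C f * gksSum Finset.univ K C g
      = ∑ pr : SpinConfig (Fin n) × SpinConfig (Fin n),
          f pr.1 * g pr.2 * (gksWeight Finset.univ K C pr.1 * gksWeight Finset.univ K C pr.2) := by
  unfold gksSum
  rw [Finset.sum_mul_sum, ← Fintype.sum_prod_type']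
  exact Finset.sum_congr rfl fun pr _ => by ring

/-! ## The two sector identities -/

/-- **Identity (I).** For `x ∈ A`, `y ∉ A` (2-separator hypothesis, `S(f) = ∑ f w`, `Z = S(1)`):
`S(σ_xσ_y) Z + S(σ_xσ_yσ_{c₁}σ_{c₂}) S(σ_{c₁}σ_{c₂}) = S(σ_xσ_{c₁}) S(σ_yσ_{c₁}) + S(σ_xσ_{c₂}) S(σ_yσ_{c₂})`
(the restricted involution identity for `F = σ_xσ_y`). [folklore] -/
theorem twoSep_identity_one {n m : ℕ} (K : Fin m → ℝ) (C : Fin m → Finset (Fin n))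
    (hC : ∀ i, (C i).card = 2) (c₁ c₂ : Fin n) (A : Finset (Fin n)) (hc₁ : c₁ ∈ A) (hc₂ : c₂ ∈ A)
    (hAB : ∀ i, C i ⊆ A ∨ C i ⊆ insert c₁ (insert c₂ Aᶜ)) {x y : Fin n} (hx : x ∈ A) (hy : y ∉ A) :
    gksSum Finset.univ K C (fun ω => spinAt x ω * spinAt y ω) * gksSum Finset.univ K C (fun _ => 1)
      + gksSum Finset.univ K C (fun ω => spinAt x ω * spinAt y ω * (spinAt c₁ ω * spinAt c₂ ω))
        * gksSum Finset.univ K C (fun ω => spinAt c₁ ω * spinAt c₂ ω)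
      = gksSum Finset.univ K C (fun ω => spinAt x ω * spinAt c₁ ω)
          * gksSum Finset.univ K C (fun ω => spinAt y ω * spinAt c₁ ω)
        + gksSum Finset.univ K C (fun ω => spinAt x ω * spinAt c₂ ω)
          * gksSum Finset.univ K C (fun ω => spinAt y ω * spinAt c₂ ω) := by
  obtain ⟨Φ, hΦ⟩ : ∃ Φ : SpinConfig (Fin n) × SpinConfig (Fin n) →
      SpinConfig (Fin n) × SpinConfig (Fin n),
      Φ = fun pr => (fun z => if z ∈ A then pr.1 z else pr.1 c₁ * pr.2 c₁ * pr.2 z,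
        fun z => if z ∈ A then pr.2 z else pr.1 c₁ * pr.2 c₁ * pr.1 z) := ⟨_, rfl⟩
  have key := twoSep_sum_swap K C hC c₁ c₂ A hc₁ hc₂ hAB Φ hΦ (fun pr => spinAt x pr.1 * spinAt y pr.1)
  rw [twoSep_gksSum_mul_gksSum, twoSep_gksSum_mul_gksSum, twoSep_gksSum_mul_gksSum,
    twoSep_gksSum_mul_gksSum, ← Finset.sum_add_distrib, ← Finset.sum_add_distrib]
  have hr : ∀ pr : SpinConfig (Fin n) × SpinConfig (Fin n),
      spinAt x (Φ pr).1 * spinAt y (Φ pr).1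
          * (1 + spinAt c₁ pr.1 * spinAt c₁ pr.2 * (spinAt c₂ pr.1 * spinAt c₂ pr.2))
          * (gksWeight Finset.univ K C pr.1 * gksWeight Finset.univ K C pr.2)
        = spinAt x pr.1 * spinAt c₁ pr.1 * (spinAt y pr.2 * spinAt c₁ pr.2)
            * (gksWeight Finset.univ K C pr.1 * gksWeight Finset.univ K C pr.2)
          + spinAt x pr.1 * spinAt c₂ pr.1 * (spinAt y pr.2 * spinAt c₂ pr.2)
            * (gksWeight Finset.univ K C pr.1 * gksWeight Finset.univ K C pr.2) := by
    intro pr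
    rw [twoSep_spinAt_swap_fst A c₁ Φ hΦ pr x, twoSep_spinAt_swap_fst A c₁ Φ hΦ pr y, if_pos hx,
      if_neg hy]
    linear_combination (spinAt x pr.1 * spinAt y pr.2 * (spinAt c₂ pr.1 * spinAt c₂ pr.2)
      * (gksWeight Finset.univ K C pr.1 * gksWeight Finset.univ K C pr.2))
      * twoSep_relSign_mul_self c₁ pr.1 pr.2
  calc _ = ∑ pr : SpinConfig (Fin n) × SpinConfig (Fin n),
        spinAt x pr.1 * spinAt y pr.1
          * (1 + spinAt c₁ pr.1 * spinAt c₁ pr.2 * (spinAt c₂ pr.1 * spinAt c₂ pr.2))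
          * (gksWeight Finset.univ K C pr.1 * gksWeight Finset.univ K C pr.2) :=
        Finset.sum_congr rfl fun pr _ => by ring
    _ = _ := key
    _ = _ := Finset.sum_congr rfl fun pr _ => hr pr

/-- **Identity (II).** For `x ∈ A`, `y ∉ A` (2-separator hypothesis, `S(f) = ∑ f w`, `Z = S(1)`):
`S(σ_xσ_yσ_{c₁}σ_{c₂}) Z + S(σ_xσ_y) S(σ_{c₁}σ_{c₂}) = S(σ_xσ_{c₂}) S(σ_yσ_{c₁}) + S(σ_xσ_{c₁}) S(σ_yσ_{c₂})`
(the restricted involution identity for `F = σ_xσ_yσ_{c₁}σ_{c₂}`). [folklore] -/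
theorem twoSep_identity_two {n m : ℕ} (K : Fin m → ℝ) (C : Fin m → Finset (Fin n))
    (hC : ∀ i, (C i).card = 2) (c₁ c₂ : Fin n) (A : Finset (Fin n)) (hc₁ : c₁ ∈ A) (hc₂ : c₂ ∈ A)
    (hAB : ∀ i, C i ⊆ A ∨ C i ⊆ insert c₁ (insert c₂ Aᶜ)) {x y : Fin n} (hx : x ∈ A) (hy : y ∉ A) :
    gksSum Finset.univ K C (fun ω => spinAt x ω * spinAt y ω * (spinAt c₁ ω * spinAt c₂ ω))
        * gksSum Finset.univ K C (fun _ => 1)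
      + gksSum Finset.univ K C (fun ω => spinAt x ω * spinAt y ω)
        * gksSum Finset.univ K C (fun ω => spinAt c₁ ω * spinAt c₂ ω)
      = gksSum Finset.univ K C (fun ω => spinAt x ω * spinAt c₂ ω)
          * gksSum Finset.univ K C (fun ω => spinAt y ω * spinAt c₁ ω)
        + gksSum Finset.univ K C (fun ω => spinAt x ω * spinAt c₁ ω)
          * gksSum Finset.univ K C (fun ω => spinAt y ω * spinAt c₂ ω) := by
  obtain ⟨Φ, hΦ⟩ : ∃ Φ : SpinConfig (Fin n) × SpinConfig (Fin n) →
      SpinConfig (Fin n) × SpinConfig (Fin n),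
      Φ = fun pr => (fun z => if z ∈ A then pr.1 z else pr.1 c₁ * pr.2 c₁ * pr.2 z,
        fun z => if z ∈ A then pr.2 z else pr.1 c₁ * pr.2 c₁ * pr.1 z) := ⟨_, rfl⟩
  have key := twoSep_sum_swap K C hC c₁ c₂ A hc₁ hc₂ hAB Φ hΦ
    (fun pr => spinAt x pr.1 * spinAt y pr.1 * (spinAt c₁ pr.1 * spinAt c₂ pr.1))
  rw [twoSep_gksSum_mul_gksSum, twoSep_gksSum_mul_gksSum, twoSep_gksSum_mul_gksSum,
    twoSep_gksSum_mul_gksSum, ← Finset.sum_add_distrib, ← Finset.sum_add_distrib]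
  have hA1 : ∀ pr : SpinConfig (Fin n) × SpinConfig (Fin n), ∀ z ∈ A,
      spinAt z (Φ pr).1 = spinAt z pr.1 := fun pr z hz => by
    rw [twoSep_spinAt_swap_fst A c₁ Φ hΦ pr z, if_pos hz]
  have hr : ∀ pr : SpinConfig (Fin n) × SpinConfig (Fin n),
      spinAt x (Φ pr).1 * spinAt y (Φ pr).1 * (spinAt c₁ (Φ pr).1 * spinAt c₂ (Φ pr).1)
          * (1 + spinAt c₁ pr.1 * spinAt c₁ pr.2 * (spinAt c₂ pr.1 * spinAt c₂ pr.2))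
          * (gksWeight Finset.univ K C pr.1 * gksWeight Finset.univ K C pr.2)
        = spinAt x pr.1 * spinAt c₂ pr.1 * (spinAt y pr.2 * spinAt c₁ pr.2)
            * (gksWeight Finset.univ K C pr.1 * gksWeight Finset.univ K C pr.2)
          + spinAt x pr.1 * spinAt c₁ pr.1 * (spinAt y pr.2 * spinAt c₂ pr.2)
            * (gksWeight Finset.univ K C pr.1 * gksWeight Finset.univ K C pr.2) := by
    intro pr
    rw [hA1 pr c₁ hc₁, hA1 pr c₂ hc₂, hA1 pr x hx, twoSep_spinAt_swap_fst A c₁ Φ hΦ pr y, if_neg hy]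
    have h1 := spinAt_mul_self c₁ pr.1
    have h2 := spinAt_mul_self c₂ pr.1
    have h3 := twoSep_relSign_mul_self c₁ pr.1 pr.2
    linear_combination
      (spinAt x pr.1 * spinAt c₂ pr.1 * (spinAt y pr.2 * spinAt c₁ pr.2)
        * (gksWeight Finset.univ K C pr.1 * gksWeight Finset.univ K C pr.2)) * h1
      + (spinAt x pr.1 * spinAt c₁ pr.1 * (spinAt y pr.2 * spinAt c₂ pr.2)
        * (gksWeight Finset.univ K C pr.1 * gksWeight Finset.univ K C pr.2)
        * (spinAt c₁ pr.1 * spinAt c₁ pr.2 * (spinAt c₁ pr.1 * spinAt c₁ pr.2))) * h2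
      + (spinAt x pr.1 * spinAt c₁ pr.1 * (spinAt y pr.2 * spinAt c₂ pr.2)
        * (gksWeight Finset.univ K C pr.1 * gksWeight Finset.univ K C pr.2)) * h3
  calc _ = ∑ pr : SpinConfig (Fin n) × SpinConfig (Fin n),
        spinAt x pr.1 * spinAt y pr.1 * (spinAt c₁ pr.1 * spinAt c₂ pr.1)
          * (1 + spinAt c₁ pr.1 * spinAt c₁ pr.2 * (spinAt c₂ pr.1 * spinAt c₂ pr.2))
          * (gksWeight Finset.univ K C pr.1 * gksWeight Finset.univ K C pr.2) :=
        Finset.sum_congr rfl fun pr _ => by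
          linear_combination
            (-(spinAt x pr.1 * spinAt y pr.1 * (spinAt c₁ pr.2 * spinAt c₂ pr.2)
              * (gksWeight Finset.univ K C pr.1 * gksWeight Finset.univ K C pr.2)))
              * (spinAt_mul_self c₁ pr.1)
            - (spinAt x pr.1 * spinAt y pr.1 * (spinAt c₁ pr.2 * spinAt c₂ pr.2)
              * (gksWeight Finset.univ K C pr.1 * gksWeight Finset.univ K C pr.2)
              * (spinAt c₁ pr.1 * spinAt c₁ pr.1)) * (spinAt_mul_self c₂ pr.1)
    _ = _ := key
    _ = _ := Finset.sum_congr rfl fun pr _ => hr pr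

/-- From a sector identity of unnormalised sums to the normalised one (divide by `Z²`). [folklore] -/
theorem twoSep_div_helper {Z a f r p₁ q₁ p₂ q₂ : ℝ} (hZ : Z ≠ 0)
    (h : a * Z + f * r = p₁ * q₁ + p₂ * q₂) :
    a / Z + f / Z * (r / Z) = p₁ / Z * (q₁ / Z) + p₂ / Z * (q₂ / Z) := by
  have hu : Z * Z⁻¹ = 1 := mul_inv_cancel₀ hZ
  simp only [div_eq_mul_inv]
  linear_combination (Z⁻¹ * Z⁻¹) * h - (a * Z⁻¹) * hu

/-! ## The registered stub -/

/-- Registered stub `helper_twoSep_markov` (core D structural fact of line `Sketch`): **Markov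
factorisation of the Ising second moments across a 2-separator.**  If every bond of the zero-field
pair system lies inside `A` or inside `B = insert c₁ (insert c₂ Aᶜ)` (`c₁, c₂ ∈ A`), then for
`x ∈ A`, `y ∈ B` and `ρ = G_{c₁c₂}`:
`(1 − ρ²) G_{xy} = (G_{yc₁} − ρ G_{yc₂}) G_{xc₁} + (G_{yc₂} − ρ G_{yc₁}) G_{xc₂}` — the combination
`(I) − ρ·(II)` of the two sector identities of the restricted involution of the duplicated system
(`twoSep_identity_one`, `twoSep_identity_two`); for `y ∈ {c₁, c₂}` it is a tautology.  The sign
hypothesis on `K` and `c₁ ≠ c₂` are not needed. [folklore] -/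
theorem helper_twoSep_markov :
    ∀ (n m : ℕ) (K : Fin m → ℝ) (C : Fin m → Finset (Fin n)), (∀ i, 0 ≤ K i) → (∀ i, (C i).card = 2) →
      ∀ (c₁ c₂ : Fin n) (A : Finset (Fin n)), c₁ ≠ c₂ → c₁ ∈ A → c₂ ∈ A →
        (∀ i, C i ⊆ A ∨ C i ⊆ insert c₁ (insert c₂ Aᶜ)) →
        ∀ G : Matrix (Fin n) (Fin n) ℝ,
          G = Matrix.of (fun p q : Fin n => gksExpect Finset.univ K C (fun ω => spinAt p ω * spinAt q ω)) →
          ∀ x y : Fin n, x ∈ A → y ∈ insert c₁ (insert c₂ Aᶜ) →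
            (1 - G c₁ c₂ ^ 2) * G x y
              = (G y c₁ - G c₁ c₂ * G y c₂) * G x c₁ + (G y c₂ - G c₁ c₂ * G y c₁) * G x c₂ := by
  intro n m K C _ hC c₁ c₂ A _ hc₁ hc₂ hAB G hG x y hx hy
  subst hG
  have hZ := (gksSum_one_pos Finset.univ K C).ne'
  rcases Finset.mem_insert.1 hy with hy1 | hy
  · have hdiag : gksExpect Finset.univ K C (fun ω => spinAt c₁ ω * spinAt c₁ ω) = 1 := by
      simp only [spinAt_mul_self]
      exact div_self hZ
    simp only [Matrix.of_apply, hy1, hdiag]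
    ring
  rcases Finset.mem_insert.1 hy with hy2 | hy
  · have hdiag : gksExpect Finset.univ K C (fun ω => spinAt c₂ ω * spinAt c₂ ω) = 1 := by
      simp only [spinAt_mul_self]
      exact div_self hZ
    have hsymm : gksExpect Finset.univ K C (fun ω => spinAt c₂ ω * spinAt c₁ ω)
        = gksExpect Finset.univ K C (fun ω => spinAt c₁ ω * spinAt c₂ ω) :=
      congrArg _ (funext fun ω => mul_comm _ _)
    simp only [Matrix.of_apply, hy2, hdiag, hsymm]
    ring
  have hy' : y ∉ A := Finset.mem_compl.1 hy
  have hI := twoSep_div_helper hZ (twoSep_identity_one K C hC c₁ c₂ A hc₁ hc₂ hAB hx hy')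
  have hII := twoSep_div_helper hZ (twoSep_identity_two K C hC c₁ c₂ A hc₁ hc₂ hAB hx hy')
  simp only [Matrix.of_apply, gksExpect]
  linear_combination hI
    - (gksSum Finset.univ K C (fun ω => spinAt c₁ ω * spinAt c₂ ω)
        / gksSum Finset.univ K C (fun _ => 1)) * hII

end Summit.CriticalPhenomena.Ising3DConformalLimit.Cruxes.InverseMFerromagnet.PartialCovarianceLadder
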